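import Literature.NumberTheory.LFunctions.Zhang2022.RepairSection18Boxes
import Literature.NumberTheory.LFunctions.Zhang2022.RepairSection9Slopes

/-!
# Zhang (2022) §18-margin repair rung: slope (centred-form) mirrors of the θ-generic §18 slice

Trunk T-ANT (NumberTheory/LFunctions). Companion of `RepairSection18Boxes.lean` (p6: INTERVAL boxes
of p1's θ-generic (18.1) coefficients `Repair.F20T … F31T`, built from `Repair.eR`, `Repair.vkR`,
`Repair.g3T/g4T`) and of `RepairSlopeArith.lean` / `RepairSection9Slopes.lean` (slope forms). For
the LOCAL cover annex of the REPAIR-or-BARRIER rung (D-0077) on Y. Zhang, arXiv:2211.02515v1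
[Zhang2022LandauSiegel], a kernel leaf runs the `LDLᴴ` elimination of the margin matrix in SLOPE
arithmetic (`RepairSlopeLDL.EntryS.pivotsPos`), which needs all ten entries as slope forms along the
one-parameter family `t ↦ θ(t)`; the `§8/§9` entries are `cDiagS/cCrossS`; this file gives the
remaining four, mirroring p6's box layer operation by operation:

* `SlopePath T c θ k₁ k₂ k₃ V₁ V₂ V₃` — the lengths of the path `θ(t)` are enclosed by the real
  slope forms `V_μ`, the shifts are the rationals `k_μ ≠ 0`, the lengths do not vanish on the cell;
* `eRS k j V T c ∋ t ↦ eR (ν t) k j` (`smem_eR`, via p6's `eR_eq_box_shape`), `vkRS` (`smem_vkR`),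
  `IS6` (`smem_I6T/I7T`), `gS` (`smem_g3T/g4T`), `triS`, and **`F20TS/F21TS/F30TS/F31TS`** with
  `SlopePath.smem_F20T …`: slope forms of `t ↦ F··T (θ t)`.

Pure slope bookkeeping; no analytic content, no facts, nothing about the manuscript's Theorems 1–2.
-/

noncomputable section

open Complex Real ComplexConjugate
open Literature.Analysis.ValidatedNumerics.Numerics

namespace Literature.NumberTheory.LFunctions.Zhang2022

namespace Repair

variable {T : FI} {c : ℚ}

/-- A slope form of `f` is one of `g` as soon as `g = f` on the cell and at the centre. [cite: Moore1966, §4.4] -/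
theorem _root_.Literature.NumberTheory.LFunctions.Zhang2022.SCB.Mem.congrOn {f g : ℝ → ℂ} {Z : SCB}
    (h : SCB.Mem T c f Z) (hT : ∀ t, FI.mem t T → g t = f t) (hc : g c = f c) : SCB.Mem T c g Z := by
  refine ⟨fun t ht => ?_, ?_, fun t ht => ?_⟩
  · rw [hT t ht]; exact h.1 t ht
  · rw [hc]; exact h.2.1
  · obtain ⟨s, hs, es⟩ := h.2.2 t ht
    exact ⟨s, hs, by rw [hT t ht, hc, es]⟩

attribute [local irreducible] CB.add CB.sub CB.mul CB.neg CB.conj CB.mulFI CB.mulI CB.mulInt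
  CB.ofFI CB.ofInt CB.normSqFI CB.expI FI.add FI.sub FI.mul FI.neg FI.mulInt FI.divNat FI.divPos
  FI.ofRat FI.ofInt FI.pi qCB piMul expIpi overPiFI piISq mulPiFI scaleRatFI recipFI
  recipMulPiFI expIpiFI

/-! ### `eR` and `vkR` along a length slope form -/

/-- slope form of the coefficient `c(ν) = (j/k²)/(νπ)` [cite: Zhang2022LandauSiegel, Lemma 15.1, Appendix B] -/
def eCoefS (k : ℚ) (j : ℕ) (V : SFI) : SFI := (invMulPiS V).scaleRat ((j : ℚ) / k ^ 2)

/-- **slope form of `t ↦ eR (ν t) k j`**: `((1 − j/k) − c·i)e^{νkπi} + c·i` in slope arithmetic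
(junk unless `eRSOK`). [cite: Zhang2022LandauSiegel, Lemma 15.1, Appendix B] -/
def eRS (k : ℚ) (j : ℕ) (V : SFI) (T : FI) (c : ℚ) : SCB :=
  (((SCB.const (qCB (1 - (j : ℚ) / k))).sub ((SCB.ofReal (eCoefS k j V)).mulI)).mul
      (SCB.expI ((V.scaleRat k).mul (SFI.const FI.pi)) T c)).add
    ((SCB.ofReal (eCoefS k j V)).mulI)

/-- validity flags of `eRS`/`vkRS` [folklore] -/
def eRSOK (k : ℚ) (V : SFI) (T : FI) (c : ℚ) : Bool :=
  invMulPiSOK V && SCB.expISOK ((V.scaleRat k).mul (SFI.const FI.pi)) T c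

/-- the length does not vanish on the cell when `invMulPiSOK` holds [cite: Moore1966, Theorem 3.1] -/
theorem ne_zero_of_invMulPiSOK {ν : ℝ → ℝ} {V : SFI} (hν : SFI.Mem T c ν V) (h : invMulPiSOK V = true) :
    (∀ t, FI.mem t T → ν t ≠ 0) ∧ ν c ≠ 0 := by
  unfold invMulPiSOK SFI.recipSOK at h
  rw [Bool.and_eq_true] at h
  have hm := SFI.mem_mul hν (SFI.mem_const (T := T) (c := c) FI.mem_pi)
  refine ⟨fun t ht => ?_, ?_⟩
  · have := SFI.ne_zero_of_recipOK h.1 (hm.1 t ht)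
    exact fun h0 => this (by simp [h0])
  · have := SFI.ne_zero_of_recipOK h.2 hm.2.1
    exact fun h0 => this (by simp [h0])

/-- **soundness of `eRS`** (`k ≠ 0`). [cite: Moore1966, §4.4] -/
theorem smem_eR {ν : ℝ → ℝ} {V : SFI} {k : ℚ} (hk : k ≠ 0) (j : ℕ) (hν : SFI.Mem T c ν V)
    (h : eRSOK k V T c = true) :
    SCB.Mem T c (fun t => eR (ν t) k j) (eRS k j V T c) := by
  unfold eRSOK at h
  rw [Bool.and_eq_true] at h
  have hc : SFI.Mem T c (fun t => ((((j : ℚ) / k ^ 2 : ℚ)) : ℝ) * invMulPi (ν t)) (eCoefS k j V) :=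
    SFI.mem_scaleRat (smem_invMulPi hν h.1) _
  have ha : SFI.Mem T c (fun t => (k : ℝ) * ν t * π) ((V.scaleRat k).mul (SFI.const FI.pi)) :=
    SFI.mem_mul (SFI.mem_scaleRat hν k) (SFI.mem_const FI.mem_pi)
  have he := SCB.mem_expI ha h.2
  have hh := SCB.mem_add
    (SCB.mem_mul (SCB.mem_sub (SCB.mem_const (mem_qCB (1 - (j : ℚ) / k)))
      (SCB.mem_mulI (SCB.mem_ofReal hc))) he)
    (SCB.mem_mulI (SCB.mem_ofReal hc))
  obtain ⟨hT, hcc⟩ := ne_zero_of_invMulPiSOK hν h.1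
  exact hh.congrOn (fun t ht => by rw [eR_eq_box_shape (hT t ht) hk j])
    (by rw [eR_eq_box_shape hcc hk j])

/-- slope form of `t ↦ vkR (ν t) k = e^{νkπi}` [cite: Zhang2022LandauSiegel, (8.6), (17.4)] -/
def vkRS (k : ℚ) (V : SFI) (T : FI) (c : ℚ) : SCB := SCB.expI ((V.scaleRat k).mul (SFI.const FI.pi)) T c

/-- **soundness of `vkRS`**. [cite: Moore1966, §4.4] -/
theorem smem_vkR {ν : ℝ → ℝ} {V : SFI} (k : ℚ) (hν : SFI.Mem T c ν V) (h : eRSOK k V T c = true) :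
    SCB.Mem T c (fun t => vkR (ν t) k) (vkRS k V T c) := by
  unfold eRSOK at h
  rw [Bool.and_eq_true] at h
  have ha : SFI.Mem T c (fun t => (k : ℝ) * ν t * π) ((V.scaleRat k).mul (SFI.const FI.pi)) :=
    SFI.mem_mul (SFI.mem_scaleRat hν k) (SFI.mem_const FI.mem_pi)
  have he := SCB.mem_expI ha h.2
  exact he.congr fun t => by unfold vkR; congr 1; push_cast; ring

/-! ### `I₆, I₇`, `g₃, g₄` -/

/-- slope form of `L = ν₁ + ν − 1` [cite: Zhang2022LandauSiegel, §12 (12.13)] -/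
def LS (V1 V : SFI) : SFI := (V1.add V).sub (SFI.const (FI.ofInt 1))

/-- soundness of `LS` [cite: Moore1966, §4.4] -/
theorem smem_L {ν1 ν : ℝ → ℝ} {V1 V : SFI} (h1 : SFI.Mem T c ν1 V1) (h : SFI.Mem T c ν V) :
    SFI.Mem T c (fun t => ν1 t + ν t - 1) (LS V1 V) := by
  have := SFI.mem_sub (SFI.mem_add h1 h) (SFI.mem_const (T := T) (c := c) (FI.mem_ofInt 1))
  exact this.congr fun t => by push_cast; ring

/-- slope form of `−L − πiL²s` [cite: Zhang2022LandauSiegel, §12 (12.13)–(12.14)] -/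
def IS6 (LI : SFI) (s : ℚ) : SCB :=
  (SCB.ofReal LI).neg.sub ((((SCB.const ((CB.ofFI FI.pi).mulI)).mulR (LI.mul LI))).mul (SCB.const (qCB s)))

/-- soundness of `IS6` [cite: Moore1966, §4.4] -/
theorem smem_IS6 {L : ℝ → ℝ} {LI : SFI} (hL : SFI.Mem T c L LI) (s : ℚ) :
    SCB.Mem T c (fun t => -(L t : ℂ) - π * I * (L t : ℂ) ^ 2 * ((s : ℚ) : ℂ)) (IS6 LI s) := by
  have hpi : CB.mem ((π : ℂ) * I) ((CB.ofFI FI.pi).mulI) := CB.mem_mulI mem_piCB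
  have hh := SCB.mem_sub (SCB.mem_neg (SCB.mem_ofReal hL))
    (SCB.mem_mul (SCB.mem_mulR (SCB.mem_const hpi) (SFI.mem_mul hL hL)) (SCB.mem_const (mem_qCB s)))
  exact hh.congr fun t => by push_cast; ring

/-- **slope form of `t ↦ I6T (θ t)`** from slope forms of `ν₁, ν₃` (`k₁, k₃` rational).
[cite: Zhang2022LandauSiegel, §12 (12.13)–(12.14)] -/
theorem smem_I6T {θ : ℝ → Theta} {V1 V3 : SFI} {k1 k3 : ℚ} (h1 : SFI.Mem T c (fun t => (θ t).nu1) V1)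
    (h3 : SFI.Mem T c (fun t => (θ t).nu3) V3) (hk1 : ∀ t, (θ t).k1 = k1) (hk3 : ∀ t, (θ t).k3 = k3) :
    SCB.Mem T c (fun t => I6T (θ t)) (IS6 (LS V1 V3) (k1 + k3 - 3)) := by
  have h := smem_IS6 (smem_L h1 h3) (k1 + k3 - 3)
  exact h.congr fun t => by unfold I6T Theta.L6; rw [hk1, hk3]; push_cast; ring

/-- **slope form of `t ↦ I7T (θ t)`** from slope forms of `ν₁, ν₂`. [cite: Zhang2022LandauSiegel, §12 (12.13)–(12.14)] -/
theorem smem_I7T {θ : ℝ → Theta} {V1 V2 : SFI} {k1 k2 : ℚ} (h1 : SFI.Mem T c (fun t => (θ t).nu1) V1)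
    (h2 : SFI.Mem T c (fun t => (θ t).nu2) V2) (hk1 : ∀ t, (θ t).k1 = k1) (hk2 : ∀ t, (θ t).k2 = k2) :
    SCB.Mem T c (fun t => I7T (θ t)) (IS6 (LS V1 V2) (k1 + k2 - 3)) := by
  have h := smem_IS6 (smem_L h1 h2) (k1 + k2 - 3)
  exact h.congr fun t => by unfold I7T Theta.L7; rw [hk1, hk2]; push_cast; ring

/-- slope form of `(4/(ν₁π))·z/ν` (junk unless `gSOK`) [cite: Zhang2022LandauSiegel, §12 (12.14)–(12.15)] -/
def gS (V1 : SFI) (ZS : SCB) (V : SFI) : SCB :=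
  ((SCB.ofReal ((invMulPiS V1).scaleRat 4)).mul ZS).mulR V.recip

/-- validity flags of `gS` [folklore] -/
def gSOK (V1 V : SFI) : Bool := invMulPiSOK V1 && V.recipSOK

/-- soundness of `gS` [cite: Moore1966, §4.4] -/
theorem smem_gS {ν1 ν : ℝ → ℝ} {z : ℝ → ℂ} {V1 V : SFI} {ZS : SCB} (h1 : SFI.Mem T c ν1 V1)
    (hz : SCB.Mem T c z ZS) (hν : SFI.Mem T c ν V) (h : gSOK V1 V = true) :
    SCB.Mem T c (fun t => ((4 / (ν1 t * π) : ℝ) : ℂ) * z t / (ν t : ℂ)) (gS V1 ZS V) := by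
  unfold gSOK at h
  rw [Bool.and_eq_true] at h
  have h4 := SFI.mem_scaleRat (smem_invMulPi h1 h.1) 4
  have hr := SFI.mem_recip hν h.2
  have hh := SCB.mem_mulR (SCB.mem_mul (SCB.mem_ofReal h4) hz) hr
  exact hh.congr fun t => by unfold invMulPi; push_cast; ring

/-- **slope form of `t ↦ g3T (θ t)`**. [cite: Zhang2022LandauSiegel, §12 (12.14)–(12.15)] -/
theorem smem_g3T {θ : ℝ → Theta} {V1 V3 : SFI} {k1 k3 : ℚ} (h1 : SFI.Mem T c (fun t => (θ t).nu1) V1)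
    (h3 : SFI.Mem T c (fun t => (θ t).nu3) V3) (hk1 : ∀ t, (θ t).k1 = k1) (hk3 : ∀ t, (θ t).k3 = k3)
    (h : gSOK V1 V3 = true) :
    SCB.Mem T c (fun t => g3T (θ t)) (gS V1 (IS6 (LS V1 V3) (k1 + k3 - 3)) V3) := by
  have := smem_gS h1 (smem_I6T h1 h3 hk1 hk3) h3 h
  exact this.congr fun t => by unfold g3T; rfl

/-- **slope form of `t ↦ g4T (θ t)`**. [cite: Zhang2022LandauSiegel, §12 (12.14)–(12.15)] -/
theorem smem_g4T {θ : ℝ → Theta} {V1 V2 : SFI} {k1 k2 : ℚ} (h1 : SFI.Mem T c (fun t => (θ t).nu1) V1)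
    (h2 : SFI.Mem T c (fun t => (θ t).nu2) V2) (hk1 : ∀ t, (θ t).k1 = k1) (hk2 : ∀ t, (θ t).k2 = k2)
    (h : gSOK V1 V2 = true) :
    SCB.Mem T c (fun t => g4T (θ t)) (gS V1 (IS6 (LS V1 V2) (k1 + k2 - 3)) V2) := by
  have := smem_gS h1 (smem_I7T h1 h2 hk1 hk2) h2 h
  exact this.congr fun t => by unfold g4T; rfl

/-! ### The (18.1) coefficients `F₂₀, F₂₁, F₃₀, F₃₁` along the path -/

/-- slope form of `−i(3a₁b₁ + 3a₂b₂ + a₃b₃ + v)` [cite: Zhang2022LandauSiegel, §18 (18.1)] -/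
def triS (a b : ℕ → SCB) (v : SCB) : SCB :=
  ((((((a 1).mul (b 1)).mulInt 3).add (((a 2).mul (b 2)).mulInt 3)).add ((a 3).mul (b 3))).add v).mulI.neg

/-- soundness of `triS` [cite: Moore1966, §4.4] -/
theorem smem_triS {f g : ℕ → ℝ → ℂ} {w : ℝ → ℂ} {a b : ℕ → SCB} {v : SCB}
    (hf : ∀ j, SCB.Mem T c (f j) (a j)) (hg : ∀ j, SCB.Mem T c (g j) (b j)) (hw : SCB.Mem T c w v) :
    SCB.Mem T c (fun t => -I * (3 * (f 1 t * g 1 t) + 3 * (f 2 t * g 2 t) + f 3 t * g 3 t + w t))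
      (triS a b v) := by
  have hh := SCB.mem_neg (SCB.mem_mulI (SCB.mem_add (SCB.mem_add (SCB.mem_add
    (SCB.mem_mulInt (SCB.mem_mul (hf 1) (hg 1)) 3) (SCB.mem_mulInt (SCB.mem_mul (hf 2) (hg 2)) 3))
    (SCB.mem_mul (hf 3) (hg 3))) hw))
  exact hh.congr fun t => by push_cast; ring

/-- slope form of `F₂₀` along the path: `−i(3e′₁₁e₃₁ + 3e′₁₂e₃₂ + e′₁₃e₃₃ + 𝔳𝔨₁𝔳𝔨₃) + 2g₃`.
[cite: Zhang2022LandauSiegel, §18 (18.1)] -/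
def F20TS (k1 k3 : ℚ) (V1 V3 : SFI) (T : FI) (c : ℚ) : SCB :=
  (triS (fun j => eRS k1 j V1 T c) (fun j => eRS k3 j V3 T c) ((vkRS k1 V1 T c).mul (vkRS k3 V3 T c))).add
    ((gS V1 (IS6 (LS V1 V3) (k1 + k3 - 3)) V3).mulInt 2)
/-- slope form of `F₂₁`: `−i(3e₂₁e₃₁ + 3e₂₂e₃₂ + e₂₃e₃₃ + 𝔳𝔨₂𝔳𝔨₃)`. [cite: Zhang2022LandauSiegel, §18 (18.1)] -/
def F21TS (k2 k3 : ℚ) (V2 V3 : SFI) (T : FI) (c : ℚ) : SCB :=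
  triS (fun j => eRS k2 j V2 T c) (fun j => eRS k3 j V3 T c) ((vkRS k2 V2 T c).mul (vkRS k3 V3 T c))
/-- slope form of `F₃₀`: `−i(3e′₁₁e₂₁ + 3e′₁₂e₂₂ + e′₁₃e₂₃ + 𝔳𝔨₁𝔳𝔨₄) + 2g₄` (`𝔳𝔨₄ := 𝔳𝔨₂`).
[cite: Zhang2022LandauSiegel, §18 (18.1)] -/
def F30TS (k1 k2 : ℚ) (V1 V2 : SFI) (T : FI) (c : ℚ) : SCB :=
  (triS (fun j => eRS k1 j V1 T c) (fun j => eRS k2 j V2 T c) ((vkRS k1 V1 T c).mul (vkRS k2 V2 T c))).add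
    ((gS V1 (IS6 (LS V1 V2) (k1 + k2 - 3)) V2).mulInt 2)
/-- slope form of `F₃₁`: `−i(3e₂₁² + 3e₂₂² + e₂₃² + 𝔳𝔨₂𝔳𝔨₄)`. [cite: Zhang2022LandauSiegel, §18 (18.1)] -/
def F31TS (k2 : ℚ) (V2 : SFI) (T : FI) (c : ℚ) : SCB :=
  triS (fun j => eRS k2 j V2 T c) (fun j => eRS k2 j V2 T c) ((vkRS k2 V2 T c).mul (vkRS k2 V2 T c))

/-- validity flags of the four coefficient slope forms [folklore] -/
def slice18SOK (k1 k2 k3 : ℚ) (V1 V2 V3 : SFI) (T : FI) (c : ℚ) : Bool :=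
  eRSOK k1 V1 T c && eRSOK k2 V2 T c && eRSOK k3 V3 T c && gSOK V1 V3 && gSOK V1 V2

/-- Hypotheses tying a path `θ(t)` of parameters to the slope data: the lengths are enclosed by the
real slope forms `V_μ` on the cell, the shifts are the rationals `k_μ ≠ 0`, and the flags hold.
[cite: Zhang2022LandauSiegel, §2 (2.21)–(2.22)] -/
structure SlopePath (T : FI) (c : ℚ) (θ : ℝ → Theta) (k1 k2 k3 : ℚ) (V1 V2 V3 : SFI) : Prop where
  /-- `ν₁(t) ∈` the slope form `V₁` -/ m1 : SFI.Mem T c (fun t => (θ t).nu1) V1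
  /-- `ν₂(t) ∈ V₂` -/ m2 : SFI.Mem T c (fun t => (θ t).nu2) V2
  /-- `ν₃(t) ∈ V₃` -/ m3 : SFI.Mem T c (fun t => (θ t).nu3) V3
  /-- `θ.k₁ = k₁` -/ hk1 : ∀ t, (θ t).k1 = k1
  /-- `θ.k₂ = k₂` -/ hk2 : ∀ t, (θ t).k2 = k2
  /-- `θ.k₃ = k₃` -/ hk3 : ∀ t, (θ t).k3 = k3
  /-- `k₁ ≠ 0` -/ k1_ne : k1 ≠ 0
  /-- `k₂ ≠ 0` -/ k2_ne : k2 ≠ 0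
  /-- `k₃ ≠ 0` -/ k3_ne : k3 ≠ 0
  /-- the flags on the cell -/ ok : slice18SOK k1 k2 k3 V1 V2 V3 T c = true

namespace SlopePath

variable {θ : ℝ → Theta} {k1 k2 k3 : ℚ} {V1 V2 V3 : SFI}

/-- the individual flags [cite: Moore1966, Theorem 3.1] -/
theorem oks (H : SlopePath T c θ k1 k2 k3 V1 V2 V3) :
    eRSOK k1 V1 T c = true ∧ eRSOK k2 V2 T c = true ∧ eRSOK k3 V3 T c = true ∧
      gSOK V1 V3 = true ∧ gSOK V1 V2 = true := by
  have h := H.ok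
  unfold slice18SOK at h
  simp only [Bool.and_eq_true] at h
  exact ⟨h.1.1.1.1, h.1.1.1.2, h.1.1.2, h.1.2, h.2⟩

/-- `e′₁ⱼ` along the path. [cite: Zhang2022LandauSiegel, Lemma 15.1] -/
theorem smem_e1pT (H : SlopePath T c θ k1 k2 k3 V1 V2 V3) (j : ℕ) :
    SCB.Mem T c (fun t => e1pT (θ t) j) (eRS k1 j V1 T c) :=
  (smem_eR H.k1_ne j H.m1 H.oks.1).congr fun t => by unfold e1pT; rw [H.hk1]
/-- `e₂ⱼ` along the path. [cite: Zhang2022LandauSiegel, Lemma 15.1] -/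
theorem smem_e2T (H : SlopePath T c θ k1 k2 k3 V1 V2 V3) (j : ℕ) :
    SCB.Mem T c (fun t => e2T (θ t) j) (eRS k2 j V2 T c) :=
  (smem_eR H.k2_ne j H.m2 H.oks.2.1).congr fun t => by unfold e2T; rw [H.hk2]
/-- `e₃ⱼ` along the path. [cite: Zhang2022LandauSiegel, Lemma 15.1] -/
theorem smem_e3T (H : SlopePath T c θ k1 k2 k3 V1 V2 V3) (j : ℕ) :
    SCB.Mem T c (fun t => e3T (θ t) j) (eRS k3 j V3 T c) :=
  (smem_eR H.k3_ne j H.m3 H.oks.2.2.1).congr fun t => by unfold e3T; rw [H.hk3]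
/-- `𝔳𝔨₁(1)` along the path. [cite: Zhang2022LandauSiegel, (17.4)] -/
theorem smem_vk1T (H : SlopePath T c θ k1 k2 k3 V1 V2 V3) :
    SCB.Mem T c (fun t => vk1T (θ t)) (vkRS k1 V1 T c) :=
  (smem_vkR k1 H.m1 H.oks.1).congr fun t => by unfold vk1T; rw [H.hk1]
/-- `𝔳𝔨₂(1)` along the path. [cite: Zhang2022LandauSiegel, (17.4)] -/
theorem smem_vk2T (H : SlopePath T c θ k1 k2 k3 V1 V2 V3) :
    SCB.Mem T c (fun t => vk2T (θ t)) (vkRS k2 V2 T c) :=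
  (smem_vkR k2 H.m2 H.oks.2.1).congr fun t => by unfold vk2T; rw [H.hk2]
/-- `𝔳𝔨₃(1)` along the path. [cite: Zhang2022LandauSiegel, (17.4)] -/
theorem smem_vk3T (H : SlopePath T c θ k1 k2 k3 V1 V2 V3) :
    SCB.Mem T c (fun t => vk3T (θ t)) (vkRS k3 V3 T c) :=
  (smem_vkR k3 H.m3 H.oks.2.2.1).congr fun t => by unfold vk3T; rw [H.hk3]
/-- `𝔳𝔨₄(1) := 𝔳𝔨₂(1)` along the path. [cite: Zhang2022LandauSiegel, (17.4), (2.27)] -/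
theorem smem_vk4T (H : SlopePath T c θ k1 k2 k3 V1 V2 V3) :
    SCB.Mem T c (fun t => vk4T (θ t)) (vkRS k2 V2 T c) :=
  (smem_vk2T H).congr fun t => by unfold vk4T; rfl

/-- **slope form of `t ↦ F20T (θ t)`**. [cite: Zhang2022LandauSiegel, §18 (18.1)] -/
theorem smem_F20T (H : SlopePath T c θ k1 k2 k3 V1 V2 V3) :
    SCB.Mem T c (fun t => F20T (θ t)) (F20TS k1 k3 V1 V3 T c) := by
  have h := SCB.mem_add
    (smem_triS (smem_e1pT H) (smem_e3T H) (SCB.mem_mul (smem_vk1T H) (smem_vk3T H)))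
    (SCB.mem_mulInt (smem_g3T H.m1 H.m3 H.hk1 H.hk3 H.oks.2.2.2.1) 2)
  exact h.congr fun t => by unfold F20T; push_cast; ring

/-- **slope form of `t ↦ F21T (θ t)`**. [cite: Zhang2022LandauSiegel, §18 (18.1)] -/
theorem smem_F21T (H : SlopePath T c θ k1 k2 k3 V1 V2 V3) :
    SCB.Mem T c (fun t => F21T (θ t)) (F21TS k2 k3 V2 V3 T c) := by
  have h := smem_triS (smem_e2T H) (smem_e3T H) (SCB.mem_mul (smem_vk2T H) (smem_vk3T H))
  exact h.congr fun t => by unfold F21T; rfl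

/-- **slope form of `t ↦ F30T (θ t)`**. [cite: Zhang2022LandauSiegel, §18 (18.1)] -/
theorem smem_F30T (H : SlopePath T c θ k1 k2 k3 V1 V2 V3) :
    SCB.Mem T c (fun t => F30T (θ t)) (F30TS k1 k2 V1 V2 T c) := by
  have h := SCB.mem_add
    (smem_triS (smem_e1pT H) (smem_e2T H) (SCB.mem_mul (smem_vk1T H) (smem_vk4T H)))
    (SCB.mem_mulInt (smem_g4T H.m1 H.m2 H.hk1 H.hk2 H.oks.2.2.2.2) 2)
  exact h.congr fun t => by unfold F30T; push_cast; ring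

/-- **slope form of `t ↦ F31T (θ t)`**. [cite: Zhang2022LandauSiegel, §18 (18.1)] -/
theorem smem_F31T (H : SlopePath T c θ k1 k2 k3 V1 V2 V3) :
    SCB.Mem T c (fun t => F31T (θ t)) (F31TS k2 V2 T c) := by
  have h := smem_triS (smem_e2T H) (smem_e2T H) (SCB.mem_mul (smem_vk2T H) (smem_vk4T H))
  exact h.congr fun t => by unfold F31T; rfl

end SlopePath

end Repair

end Literature.NumberTheory.LFunctions.Zhang2022
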